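import Mathlib
import Summits.ValiantsHypothesis.ValiantsHypothesis.Theorems.NewtonUnitEquationsTwoProductsFormalLogLinearisationDefs
import HarnessLib

/-!
# Route NewtonUnitEquations — crux `TwoProducts` (stmt-ValiantsHypothesis-5906), line `formal-log-linearisation`:
# the TORUS-TWIST identity for the log-sum (the fully aligned case of fibre cancellation; theory lane on stub 5)

Registered line `Cruxes/TwoProducts/Lines/formal-log-linearisation.lean` (NOT the item's skeleton of record; helper
mode `--supports stmt-ValiantsHypothesis-5906 --as helper`, no stub credit claimed).  Vocabulary (`Expo`, `logCoeff`,
`logDiff`, `logSupport`) = the line's, verbatim, from the ONE Defs file.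

Memo v3 (evidence on the item) locates the OPEN content of the engine `stub_logSumEngine` in FIBRE CANCELLATION and
identifies its source as alignment of the tails' coefficient configuration with the toric variety of the common support:
the fully aligned case is the TORUS-TWIST family (Disproof §3 F7) in which every tail is a torus translate
`u_ρ(X) = U(t_ρ ⊙ X)` of one tail `U`.  This file makes that family a tree object:

* `coeff_aeval_torusTwist` — the twist `U ↦ U(t ⊙ X)` is the algebra map `aeval (fun i => C (t i) * X i)`, and
  `coeff n (U(t ⊙ X)) = t^n · coeff n U` (`t^n = ∏ tᵢ^{nᵢ}`); `coeff_zero_aeval_torusTwist` — zero constant terms are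
  preserved; `support_aeval_torusTwist_subset` — sparsity is preserved;
* `logCoeff_torusTwist` — **`[log(1 + U(t ⊙ X))]_n = t^n · [log(1 + U)]_n`** (the twist is a ring map, so it commutes with
  the finite truncation defining `logCoeff`);
* `logDiff_torusTwist` — for twisted families `u_ρ = U(t_ρ ⊙ X)`, `v_ρ = U(t'_ρ ⊙ X)`:
  **`logDiff u v n = [log(1+U)]_n · Φ(n)`**, `Φ(n) = Σ_ρ t_ρ^n − Σ_ρ t'_ρ^n` a planar `2m`-term signed exponential sum;
* `logSupport_torusTwist` — hence `supp D = supp log(1+U) ∩ {Φ ≠ 0}`: in the aligned case the visible points of the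
  log-sum are governed by ONE universal support and ONE planar exponential sum (to which the lifted hyperbolic-cross /
  antichain counts of the sibling files apply wherever `supp log(1+U)` has no holes below the point).

Honest framing: a structural identity for the THEORY lane of an OPEN engine; `stub_logSumEngine` (open content: fibre
cancellation under PARTIAL alignment + the extreme regime, memo v2/v3) and the crux `TwoProducts` stay OPEN, the line is
not the item's skeleton of record, and nothing here is progress on `VP ≠ VNP` (NOT proved). No definitions, no named facts.
-/

noncomputable section

-- Sub = Summit single-conjunct layout: the duplicated namespace component is mandated by the tree.
set_option linter.dupNamespace false

namespace Summit.ValiantsHypothesis.ValiantsHypothesis.Theorems.NewtonUnitEquations.TwoProducts.FormalLogLinearisation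

open MvPolynomial
open scoped BigOperators

variable {m : ℕ}

/-- The torus twist of a monomial: `(c X^e)(t ⊙ X) = (c · t^e) X^e`. [folklore] -/
theorem aeval_torusTwist_monomial (t : Fin 2 → ℂ) (e : Expo) (c : ℂ) :
    aeval (fun i => C (t i) * X i) (monomial e c) = monomial e (c * ∏ i, t i ^ e i) := by
  rw [aeval_monomial, algebraMap_eq]
  have hprod : (e.prod fun i k => (C (t i) * X i : MvPolynomial (Fin 2) ℂ) ^ k) =
      C (e.prod fun i k => t i ^ k) * e.prod fun i k => (X i : MvPolynomial (Fin 2) ℂ) ^ k := by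
    rw [map_finsuppProd]
    rw [← Finsupp.prod_mul]
    exact Finsupp.prod_congr fun i _ => by rw [mul_pow, map_pow]
  rw [hprod, ← mul_assoc, ← map_mul, ← monomial_eq, Finsupp.prod_fintype _ _ (fun i => by simp)]

/-- **Coefficients under the torus twist**: `coeff n (U(t ⊙ X)) = t^n · coeff n U`. [folklore] -/
theorem coeff_aeval_torusTwist (t : Fin 2 → ℂ) (U : MvPolynomial (Fin 2) ℂ) (n : Expo) :
    coeff n (aeval (fun i => C (t i) * X i) U) = (∏ i, t i ^ n i) * coeff n U := by
  classical
  conv_lhs => rw [U.as_sum, map_sum]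
  simp only [aeval_torusTwist_monomial, coeff_sum, coeff_monomial]
  rw [Finset.sum_ite_eq']
  split_ifs with h
  · ring
  · rw [notMem_support_iff.mp h, mul_zero]

/-- The torus twist preserves the constant term. [folklore] -/
theorem coeff_zero_aeval_torusTwist (t : Fin 2 → ℂ) (U : MvPolynomial (Fin 2) ℂ) :
    coeff 0 (aeval (fun i => C (t i) * X i) U) = coeff 0 U := by
  rw [coeff_aeval_torusTwist]; simp

/-- The torus twist does not enlarge the support (so sparsity `≤ t` is preserved). [folklore] -/
theorem support_aeval_torusTwist_subset (t : Fin 2 → ℂ) (U : MvPolynomial (Fin 2) ℂ) :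
    (aeval (fun i => C (t i) * X i) U).support ⊆ U.support := by
  intro n hn
  rw [mem_support_iff, coeff_aeval_torusTwist] at hn
  exact mem_support_iff.mpr (right_ne_zero_of_mul hn)

/-- **TORUS-TWIST IDENTITY for the formal logarithm**: `[log(1 + U(t ⊙ X))]_n = t^n · [log(1 + U)]_n` (the line's
`logCoeff`, an exact finite truncation; the twist is a ring homomorphism, so `U(t⊙X)^r = (U^r)(t⊙X)`). [folklore] -/
theorem logCoeff_torusTwist (t : Fin 2 → ℂ) (U : MvPolynomial (Fin 2) ℂ) (n : Expo) :
    logCoeff (aeval (fun i => C (t i) * X i) U) n = (∏ i, t i ^ n i) * logCoeff U n := by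
  simp only [logCoeff, ← map_pow, coeff_aeval_torusTwist, Finset.mul_sum]
  exact Finset.sum_congr rfl fun r _ => by ring

/-- **Aligned families factor**: if every tail is a torus translate of one tail `U` — `u_ρ = U(t_ρ ⊙ X)`,
`v_ρ = U(t'_ρ ⊙ X)` — then the log-sum's coefficients FACTOR as
`logDiff u v n = [log(1+U)]_n · (Σ_ρ t_ρ^n − Σ_ρ t'_ρ^n)`: one universal support times a planar `2m`-term signed
exponential sum `Φ`. (Disproof §3 F7's torus-twist family; memo v3: the fully aligned case of fibre cancellation.)
[folklore] -/
theorem logDiff_torusTwist (U : MvPolynomial (Fin 2) ℂ) (t t' : Fin m → Fin 2 → ℂ)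
    (u v : Fin m → MvPolynomial (Fin 2) ℂ) (hu : ∀ ρ, u ρ = aeval (fun i => C (t ρ i) * X i) U)
    (hv : ∀ ρ, v ρ = aeval (fun i => C (t' ρ i) * X i) U) (n : Expo) :
    logDiff u v n = logCoeff U n * ((∑ ρ, ∏ i, t ρ i ^ n i) - ∑ ρ, ∏ i, t' ρ i ^ n i) := by
  simp only [logDiff, hu, hv, logCoeff_torusTwist, Finset.mul_sum, mul_sub]
  congr 1 <;> exact Finset.sum_congr rfl fun ρ _ => by ring

/-- **Support of the log-sum in the aligned case**: `supp D = supp log(1+U) ∩ {Φ ≠ 0}` with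
`Φ(n) = Σ_ρ t_ρ^n − Σ_ρ t'_ρ^n`.  Consequently every visible point of the log-sum (`logVisible`) lies in the universal
support `{n : [log(1+U)]_n ≠ 0}` and in the non-vanishing set of the planar exponential sum `Φ`. [folklore] -/
theorem logSupport_torusTwist (U : MvPolynomial (Fin 2) ℂ) (t t' : Fin m → Fin 2 → ℂ)
    (u v : Fin m → MvPolynomial (Fin 2) ℂ) (hu : ∀ ρ, u ρ = aeval (fun i => C (t ρ i) * X i) U)
    (hv : ∀ ρ, v ρ = aeval (fun i => C (t' ρ i) * X i) U) :
    logSupport u v =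
      {n | logCoeff U n ≠ 0 ∧ ((∑ ρ, ∏ i, t ρ i ^ n i) - ∑ ρ, ∏ i, t' ρ i ^ n i) ≠ 0} := by
  ext n
  simp only [logSupport, Set.mem_setOf_eq, logDiff_torusTwist U t t' u v hu hv n, mul_ne_zero_iff]

/-- Visible points of an aligned family lie in the universal support and off the zero set of `Φ`. [folklore] -/
theorem logVisible_torusTwist_subset (U : MvPolynomial (Fin 2) ℂ) (t t' : Fin m → Fin 2 → ℂ)
    (u v : Fin m → MvPolynomial (Fin 2) ℂ) (hu : ∀ ρ, u ρ = aeval (fun i => C (t ρ i) * X i) U)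
    (hv : ∀ ρ, v ρ = aeval (fun i => C (t' ρ i) * X i) U) :
    logVisible u v ⊆
      {n | logCoeff U n ≠ 0 ∧ ((∑ ρ, ∏ i, t ρ i ^ n i) - ∑ ρ, ∏ i, t' ρ i ^ n i) ≠ 0} := by
  intro n hn
  obtain ⟨ξ, -, htop⟩ := hn
  have hmem : n ∈ logSupport u v := htop.1
  rwa [logSupport_torusTwist U t t' u v hu hv] at hmem

end Summit.ValiantsHypothesis.ValiantsHypothesis.Theorems.NewtonUnitEquations.TwoProducts.FormalLogLinearisation

end
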